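import Mathlib.AlgebraicGeometry.Sites.EtalePoint
import Mathlib.AlgebraicGeometry.Morphisms.QuasiCompact
import Mathlib.CategoryTheory.Sites.CoverPreserving
import Mathlib.CategoryTheory.Limits.MorphismProperty
import Mathlib.CategoryTheory.Limits.Preserves.FunctorCategory
import Mathlib.CategoryTheory.Functor.Flat
import Mathlib.CategoryTheory.Sites.Point.Comap
import Mathlib.CategoryTheory.Preadditive.Injective.Basic
import Literature.AlgebraicGeometry.Motives.EtaleCohomologicalDimension
import HarnessLib

/-!
# Direct images of étale sheaves (Milne II §3): `π_*`, its left exactness, skyscrapers, degree 0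

For a morphism of schemes `f : X ⟶ Y` this file constructs, on Mathlib's small étale sites
(`Scheme.Etale`, `Scheme.smallEtaleTopology`), the **direct image functor**
`π_* = etalePushforward f A : Sheaf X_et A ⥤ Sheaf Y_et A`, `(π_* F)(U) = F(U ×_Y X)` (Milne II §3,
"the direct image of a sheaf", (3.0); Stacks `f_{small,*}`), and proves the formal part of what
Serre's proof of `cd_p(G_{k'}) ≤ cd_p(G_k)` (II §4.1 Prop. 10 ⇐ I §3.3 Prop. 14 ⇐ I §2.5 Prop. 10,
Faddeev–Shapiro) needs about the coinduction functor `M_G^H`, in its étale reading `π_*` for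
`π : Spec K → Spec k`:

* `etaleBaseChange f : Y.Etale ⥤ X.Etale`, `U ↦ U ×_Y X` (Mathlib `MorphismProperty.Over.pullback`),
  is cover preserving (`etaleBaseChange_coverPreserving`: the base change of a jointly surjective
  family of étale maps is jointly surjective, via the cartesian squares
  `isPullback_etaleBaseChange_map_left`) and representably flat, hence **continuous**;
* `etalePushforward f A` (**definition**, `sheafPushforwardContinuous`), additive, **preserves all
  limits** (`preservesLimitsOfShape_etalePushforward`: limits of sheaves are objectwise), and
  preserves Milne's `ℓ`-torsion sheaves when `f` is quasi-compact
  (`IsEllTorsionSheaf.etalePushforward`);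
* geometric points: for `y : Spec Ω → X`, `Ω` separably closed, the fibre functor of Mathlib's point
  `pointSmallEtale y` composed with base change is the fibre functor of `pointSmallEtale (y ≫ f)`
  (`etaleBaseChangeCompFiberIso`), so `y` defines a point `etaleBaseChangeComapPoint f y` of `Y_et`
  (Mathlib `Point.comap`) with `π_* (skyscraper_y M) = skyscraper_{f y} M` **definitionally**
  (`etalePushforward_obj_skyscraperSheaf`); consequently `π_*` of a skyscraper sheaf with
  injective value is an **injective** abelian sheaf (`injective_etalePushforward_skyscraperSheaf`)
  — the étale counterpart of "`M_G^H` transforme injectifs en injectifs" (Serre I §2.5);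
* degree `0`: the canonical `u : M_Y ⟶ π_* M_X` between constant sheaves
  (`etalePushforwardConstantSheafUnit`) and the bijection `Hom(M_X, G) ≃ Hom(M_Y, π_* G)`,
  `g ↦ u ≫ π_* g` (`bijective_etalePushforwardConstantSheafUnit_comp_map`): both sides are
  `Hom_A(M, G(Y ×_Y X))` (Serre: "`Hom^G(B, M_G^H(A)) = Hom^H(B, A)`" for `B = ℤ`).

The right exactness of `π_*` for integral `f` (Stacks 04C2, Milne II Cor. 3.6) is NOT proved here;
it is the named fact `etalePushforward_exact_of_isAlgebraic` of
`EtaleCohomologicalDimensionAlgebraic.lean`, where Shapiro's lemma and the algebraic case of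
Tate's theorem are derived from it.

## References

* J. S. Milne, *Étale cohomology*, Princeton (reissue 2025): II §3 (direct and inverse images,
  (3.0), Cor. 3.5 (c), Cor. 3.6), II Thm. 1.9, III Example 1.7 (a). [Milne2025]
* J.-P. Serre, *Cohomologie galoisienne*, 5e éd., Springer (1997): I §2.5 (modules induits,
  Prop. 10), I §3.3 Prop. 14, II §4.1 Prop. 10. [SerreGaloisCohomology1997]
* The Stacks Project, Tags 04C2, 03QP, 04DO–04DR (`f_{small,*}` for integral `f`). [StacksProject]

## Design notes

* Everything is stated for Mathlib's large site `X.Etale : Type (u+1)` (all étale `X`-schemes)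
  with `A`-valued sheaves; no inverse image functor `π^*` is constructed (its left Kan extension
  would need `(u+1)`-indexed colimits in `A`): left exactness of `π_*` comes from `sheafToPresheaf`
  creating limits, and injectivity of `π_*`(skyscraper) from Mathlib's `Point.comap` and the
  stalk ⊣ skyscraper adjunction, not from an exact left adjoint.
* `etaleBaseChange` is an `abbrev` for `MorphismProperty.Over.pullback @Etale ⊤ f`; the instances
  `PreservesFiniteLimits` / `RepresentablyFlat` are re-exposed on it because `Scheme.Etale` is a
  `def` (instance search does not unfold it); they are Mathlib's instances, not new ones.
* `set_option backward.isDefEq.respectTransparency false` is used, as in Mathlib's own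
  `AlgebraicGeometry/Sites/Etale*.lean`, for the one proof unfolding `Scheme.Etale`.
-/

universe v' u' u

open CategoryTheory CategoryTheory.Limits AlgebraicGeometry Opposite

namespace Literature.AlgebraicGeometry.Motives

variable {X Y : Scheme.{u}} (f : X ⟶ Y)

/-! ### Base change of étale schemes is a continuous functor of small étale sites -/

/-- **Base change of étale schemes** along `f : X ⟶ Y`: the functor `Y_et → X_et`,
`(U → Y) ↦ (U ×_Y X → X)` underlying the morphism of sites `π : X_et → Y_et` (Milne II §3:
"`π⁻¹(U) = U ×_Y X`"); Mathlib's `MorphismProperty.Over.pullback`.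
[cite: Milne2025, II §3 (direct and inverse images of sheaves)] -/
noncomputable abbrev etaleBaseChange : Y.Etale ⥤ X.Etale :=
  MorphismProperty.Over.pullback @Etale ⊤ f

/-- Base change preserves finite limits (Mathlib's instance for `MorphismProperty.Over.pullback`,
re-exposed on `Scheme.Etale`). [folklore] -/
instance preservesFiniteLimits_etaleBaseChange : PreservesFiniteLimits (etaleBaseChange f) :=
  inferInstanceAs (PreservesFiniteLimits (MorphismProperty.Over.pullback @Etale ⊤ f))

/-- Base change is representably flat (it preserves the finite limits of `Y_et`). [folklore] -/
instance representablyFlat_etaleBaseChange : RepresentablyFlat (etaleBaseChange f) :=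
  flat_of_preservesFiniteLimits _

set_option backward.isDefEq.respectTransparency false in
/-- For `g : V ⟶ U` in `Y_et`, the square `V ×_Y X → U ×_Y X` over `V → U` is cartesian
(pasting of the two cartesian squares over `f`). [folklore] -/
theorem isPullback_etaleBaseChange_map_left {V U : Y.Etale} (g : V ⟶ U) :
    IsPullback ((etaleBaseChange f).map g).left (pullback.fst V.hom f) (pullback.fst U.hom f)
      g.left := by
  have t : IsPullback ((etaleBaseChange f).obj U).hom (pullback.fst U.hom f) f U.hom :=
    (IsPullback.of_hasPullback U.hom f).flip
  have s : IsPullback (((etaleBaseChange f).map g).left ≫ ((etaleBaseChange f).obj U).hom)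
      (pullback.fst V.hom f) f (g.left ≫ U.hom) := by
    rw [MorphismProperty.Over.w, MorphismProperty.Over.w]
    exact (IsPullback.of_hasPullback V.hom f).flip
  exact IsPullback.of_right s (pullback.lift_fst _ _ _) t

set_option backward.isDefEq.respectTransparency false in
/-- Points of `U ×_Y X` over a point in the image of `V → U` lift to `V ×_Y X` (surjectivity on
points of base changes, Mathlib `Scheme.Pullback.exists_preimage_pullback`). [folklore] -/
theorem exists_etaleBaseChange_map_left_apply_eq {V U : Y.Etale} (g : V ⟶ U)
    (p : ↥((etaleBaseChange f).obj U).left) (z : ↥V.left)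
    (hz : g.left z = pullback.fst U.hom f p) :
    ∃ q : ↥((etaleBaseChange f).obj V).left, ((etaleBaseChange f).map g).left q = p := by
  obtain ⟨r, hr, -⟩ := Scheme.Pullback.exists_preimage_pullback
    (f := (pullback.fst U.hom f : ((etaleBaseChange f).obj U).left ⟶ U.left))
    (g := g.left) p z hz.symm
  refine ⟨(isPullback_etaleBaseChange_map_left f g).isoPullback.inv r, ?_⟩
  simp only [← Scheme.Hom.comp_apply, IsPullback.isoPullback_inv_fst]
  exact hr

/-- **Base change along `f` sends étale coverings to étale coverings**: jointly surjective
families of étale maps are stable under base change, so `etaleBaseChange f` is cover preserving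
for the small étale topologies (Milne II §3: `π` "defines a morphism of sites"). [folklore] -/
theorem etaleBaseChange_coverPreserving :
    CoverPreserving Y.smallEtaleTopology X.smallEtaleTopology (etaleBaseChange f) where
  cover_preserve {U S} hS := by
    obtain ⟨I, Z, g, rfl⟩ := S.exists_eq_ofArrows
    rw [Scheme.ofArrows_mem_smallEtaleTopology_iff] at hS
    refine X.smallEtaleTopology.superset_covering (S := Sieve.ofArrows
      (fun i => (etaleBaseChange f).obj (Z i)) (fun i => (etaleBaseChange f).map (g i))) ?_ ?_
    · rw [Sieve.ofArrows, Sieve.generate_le_iff]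
      rintro _ _ ⟨i⟩
      exact Sieve.image_mem_functorPushforward _ _ (Sieve.ofArrows_mk Z g i)
    · rw [Scheme.ofArrows_mem_smallEtaleTopology_iff, Set.eq_univ_iff_forall]
      intro p
      have hu : pullback.fst U.hom f p ∈ ⋃ i, Set.range (g i).left := by rw [hS]; trivial
      obtain ⟨i, z, hz⟩ := Set.mem_iUnion.1 hu
      obtain ⟨q, hq⟩ := exists_etaleBaseChange_map_left_apply_eq f (g i) p z hz
      exact Set.mem_iUnion.2 ⟨i, q, hq⟩

/-- Base change is a **continuous** functor `Y_et → X_et` (cover preserving and representably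
flat), i.e. `f` induces a morphism of small étale sites. [folklore] -/
instance isContinuous_etaleBaseChange :
    (etaleBaseChange f).IsContinuous Y.smallEtaleTopology X.smallEtaleTopology :=
  Functor.isContinuous_iff_coverPreserving.2 (etaleBaseChange_coverPreserving f)

/-! ### The direct image functor `π_*` -/

section Pushforward

variable (A : Type u') [Category.{v'} A]

/-- **Direct image of étale sheaves** along `f : X ⟶ Y` (Milne II §3, `π_*`; Stacks
`f_{small,*}`): the sheaf `U ↦ F(U ×_Y X)` on the small étale site of `Y`, i.e. precomposition
with the continuous base-change functor (Mathlib `Functor.sheafPushforwardContinuous`).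
[cite: Milne2025, II §3 (direct images, (3.0))] -/
noncomputable def etalePushforward :
    Sheaf X.smallEtaleTopology A ⥤ Sheaf Y.smallEtaleTopology A :=
  (etaleBaseChange f).sheafPushforwardContinuous A Y.smallEtaleTopology X.smallEtaleTopology

variable {A}

/-- `(π_* F)(U) = F(U ×_Y X)`. [folklore] -/
@[simp]
theorem etalePushforward_obj_obj_obj (F : Sheaf X.smallEtaleTopology A) (U : Y.Etaleᵒᵖ) :
    ((etalePushforward f A).obj F).obj.obj U = F.obj.obj (op ((etaleBaseChange f).obj U.unop)) :=
  rfl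

/-- The restriction maps of `π_* F` are those of `F` along base changes. [folklore] -/
@[simp]
theorem etalePushforward_obj_obj_map (F : Sheaf X.smallEtaleTopology A) {U V : Y.Etaleᵒᵖ}
    (i : U ⟶ V) :
    ((etalePushforward f A).obj F).obj.map i = F.obj.map ((etaleBaseChange f).map i.unop).op :=
  rfl

/-- `π_*` on morphisms: `(π_* φ)_U = φ_{U ×_Y X}`. [folklore] -/
@[simp]
theorem etalePushforward_map_hom_app {F F' : Sheaf X.smallEtaleTopology A} (φ : F ⟶ F')
    (U : Y.Etaleᵒᵖ) :
    ((etalePushforward f A).map φ).hom.app U = φ.hom.app (op ((etaleBaseChange f).obj U.unop)) :=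
  rfl

/-- `π_*` is an additive functor. [folklore] -/
instance additive_etalePushforward [Preadditive A] : (etalePushforward f A).Additive where

variable (A) in
/-- **`π_*` preserves all limits** that exist in `A` (limits of sheaves are computed objectwise:
`sheafToPresheaf` creates them); in particular `π_*` is left exact ("`π_*` is left exact and
commutes with inverse limits", Milne II §3). [cite: Milne2025, II §3 (3.0)] -/
instance preservesLimitsOfShape_etalePushforward (K : Type*) [Category K]
    [HasLimitsOfShape K A] : PreservesLimitsOfShape K (etalePushforward f A) :=
  have : PreservesLimitsOfShape K (etalePushforward f A ⋙ sheafToPresheaf _ A) :=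
    inferInstanceAs (PreservesLimitsOfShape K (sheafToPresheaf _ A ⋙
      (Functor.whiskeringLeft _ _ A).obj (etaleBaseChange f).op))
  preservesLimitsOfShape_of_reflects_of_preserves _ (sheafToPresheaf _ A)

/-- `π_*` is left exact. [folklore] -/
instance preservesFiniteLimits_etalePushforward [HasFiniteLimits A] :
    PreservesFiniteLimits (etalePushforward f A) :=
  ⟨fun _ _ _ => inferInstance⟩

end Pushforward

/-- `π_*` along a quasi-compact morphism preserves `ℓ`-torsion sheaves in Milne's sense (VI §1):
`(π_* F)(U) = F(U ×_Y X)` and `U ×_Y X` is quasi-compact when `U` is; this is "`M_G^H(A)` est un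
`G`-module discret de torsion" in Serre I §3.3, proof of Prop. 14. [folklore] -/
theorem IsEllTorsionSheaf.etalePushforward [QuasiCompact f] {ℓ : ℕ}
    {F : Sheaf X.smallEtaleTopology Ab.{u}} (hF : IsEllTorsionSheaf ℓ F) :
    IsEllTorsionSheaf ℓ ((etalePushforward f Ab.{u}).obj F) := by
  intro U hU s
  have hU' : CompactSpace ↥((𝟭 Scheme).obj U.left) := hU
  exact hF ((etaleBaseChange f).obj U)
    (@QuasiCompact.compactSpace_of_compactSpace _ _ (pullback.fst U.hom f)
      (MorphismProperty.pullback_fst (P := @QuasiCompact) _ _ ‹QuasiCompact f›) hU') s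

/-! ### Geometric points: `π_*` of a skyscraper sheaf is a skyscraper sheaf -/

section Points

variable {Ω : Type u} [Field Ω] [IsSepClosed Ω] (y : Spec (.of Ω) ⟶ X)

/-- The fibre functor of the geometric point `y` of `X` precomposed with base change along
`f : X ⟶ Y` is the fibre functor of the geometric point `y ≫ f` of `Y`:
`Hom_X(ȳ, U ×_Y X) ≅ Hom_Y(ȳ, U)` naturally in `U` (adjunction `Over.map f ⊣ Over.pullback f`);
cf. Milne II 3.2–3.5 on stalks of direct images. [folklore] -/
noncomputable def etaleBaseChangeCompFiberIso :
    etaleBaseChange f ⋙ (Scheme.pointSmallEtale y).fiber ≅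
      (Scheme.pointSmallEtale (y ≫ f)).fiber :=
  Functor.isoWhiskerLeft (Scheme.Etale.forget Y)
    (((Over.mapPullbackAdj f).compCoyonedaIso.app (op (Over.mk y))).symm)

/-- The category of elements of `U ↦ Hom_X(ȳ, U ×_Y X)` is initially small (it is equivalent to
that of the fibre functor of `y ≫ f`). [folklore] -/
instance initiallySmall_elements_etaleBaseChange_comp_fiber :
    InitiallySmall.{u} (etaleBaseChange f ⋙ (Scheme.pointSmallEtale y).fiber).Elements := by
  haveI : InitiallySmall.{u}
      (Functor.elementsFunctor.obj (Scheme.pointSmallEtale (y ≫ f)).fiber) :=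
    (Scheme.pointSmallEtale (y ≫ f)).initiallySmall
  exact initiallySmall_of_initial_of_initiallySmall
    (Cat.equivOfIso (Functor.elementsFunctor.mapIso
      (etaleBaseChangeCompFiberIso f y).symm)).functor

/-- The image under `f` of the geometric point `y` of `X` as a point of the small étale site of
`Y`, in the form `Point.comap` (fibre functor `U ↦ Hom_X(ȳ, U ×_Y X)`), for which
`π_* (skyscraper_y M) = skyscraper M` holds definitionally. [folklore] -/
noncomputable def etaleBaseChangeComapPoint : Y.smallEtaleTopology.Point :=
  (Scheme.pointSmallEtale y).comap (etaleBaseChange f) (etaleBaseChange_coverPreserving f)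

variable (A : Type u') [Category.{v'} A] [HasProducts.{u} A]

/-- **`π_*` of the skyscraper sheaf at `ȳ` is the skyscraper sheaf at `f(ȳ)`**
(`(π_* F)_{x̄}` for skyscrapers, cf. Milne II Cor. 3.5), definitionally (Mathlib
`skyscraperSheafFunctorCompSheafPushforwardContinuous`). [folklore] -/
theorem etalePushforward_obj_skyscraperSheaf (M : A) :
    (etalePushforward f A).obj ((Scheme.pointSmallEtale y).skyscraperSheaf M) =
      (etaleBaseChangeComapPoint f y).skyscraperSheaf M :=
  rfl

/-- **`π_*` of a skyscraper sheaf with injective value is injective**: it is a skyscraper sheaf,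
the image of an injective under the right adjoint of an exact fibre functor. Étale counterpart
of "`M_G^H` transforme injectifs en injectifs" (Serre I §2.5, proof of Prop. 10).
[cite: SerreGaloisCohomology1997, I §2.5, proof of Prop. 10] -/
theorem injective_etalePushforward_skyscraperSheaf (M : Ab.{u}) [Injective M] :
    Injective ((etalePushforward f Ab.{u}).obj ((Scheme.pointSmallEtale y).skyscraperSheaf M)) :=
  Injective.injective_of_adjoint (etaleBaseChangeComapPoint f y).skyscraperSheafAdjunction M

/-- The skyscraper sheaf at a geometric point with injective value is an injective abelian
sheaf. [folklore] -/
theorem injective_skyscraperSheaf (M : Ab.{u}) [Injective M] :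
    Injective ((Scheme.pointSmallEtale y).skyscraperSheaf M) :=
  Injective.injective_of_adjoint (Scheme.pointSmallEtale y).skyscraperSheafAdjunction M

end Points

/-! ### Degree zero: `Hom(M_X, G) ≅ Hom(M_Y, π_* G)` for constant sheaves -/

section DegreeZero

variable (A : Type u') [Category.{v'} A] [HasWeakSheafify X.smallEtaleTopology A]
  [HasWeakSheafify Y.smallEtaleTopology A]

/-- `Y ×_Y X`, the base change of the final object `Y` of `Y_et`, is a final object of `X_et`
(base change preserves finite limits). [folklore] -/
noncomputable def isTerminalEtaleBaseChangeObjMkId :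
    IsTerminal ((etaleBaseChange f).obj (Scheme.Etale.mk (𝟙 Y))) :=
  (isTerminalEtaleMkId Y).isTerminalObj (etaleBaseChange f)

variable {A} in
/-- The canonical morphism `u : M_Y ⟶ π_* M_X` from the constant sheaf on `Y_et` to the direct
image of the constant sheaf on `X_et` with the same value `M`: under
`Hom(M_Y, π_* M_X) ≅ Hom_A(M, (π_* M_X)(Y)) = Hom_A(M, M_X(Y ×_Y X)) ≅ Hom(M_X, M_X)` it
corresponds to the identity. For `M = ℤ` it induces the Shapiro maps
`Hⁿ(X_et, G) → Hⁿ(Y_et, π_* G)`. [folklore] -/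
noncomputable def etalePushforwardConstantSheafUnit (M : A) :
    (constantSheaf Y.smallEtaleTopology A).obj M ⟶
      (etalePushforward f A).obj ((constantSheaf X.smallEtaleTopology A).obj M) :=
  ((constantSheafAdj _ A (isTerminalEtaleMkId Y)).homEquiv _ _).symm
    ((constantSheafAdj _ A (isTerminalEtaleBaseChangeObjMkId f)).homEquiv _ _ (𝟙 _))

variable {A} in
/-- Naturality: `u ≫ π_* g` corresponds to `g` under the two adjunctions
`constant sheaf ⊣ sections over the final object`. [folklore] -/
theorem etalePushforwardConstantSheafUnit_comp_map (M : A) {G : Sheaf X.smallEtaleTopology A}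
    (g : (constantSheaf _ A).obj M ⟶ G) :
    etalePushforwardConstantSheafUnit f M ≫ (etalePushforward f A).map g =
      ((constantSheafAdj _ A (isTerminalEtaleMkId Y)).homEquiv _ _).symm
        ((constantSheafAdj _ A (isTerminalEtaleBaseChangeObjMkId f)).homEquiv _ _ g) := by
  dsimp only [etalePushforwardConstantSheafUnit]
  rw [← Adjunction.homEquiv_naturality_right_symm]
  congr 1
  conv_rhs => rw [← Category.id_comp g, Adjunction.homEquiv_naturality_right]
  rfl

variable {A} in
/-- **Degree zero of Shapiro's lemma**: `g ↦ u ≫ π_* g` is a bijection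
`Hom(M_X, G) ≃ Hom(M_Y, π_* G)` — both sides are `Hom_A(M, G(Y ×_Y X))` by the adjunctions
`constant sheaf ⊣ sections over the final object` on `X_et` and on `Y_et` (Serre I §2.5:
"`Hom^G(B, M_G^H(A)) = Hom^H(B, A)`", `B = ℤ`).
[cite: SerreGaloisCohomology1997, I §2.5, proof of Prop. 10] -/
theorem bijective_etalePushforwardConstantSheafUnit_comp_map (M : A)
    (G : Sheaf X.smallEtaleTopology A) :
    Function.Bijective fun g : (constantSheaf _ A).obj M ⟶ G =>
      etalePushforwardConstantSheafUnit f M ≫ (etalePushforward f A).map g := by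
  rw [show (fun g : (constantSheaf _ A).obj M ⟶ G =>
      etalePushforwardConstantSheafUnit f M ≫ (etalePushforward f A).map g) =
      ((constantSheafAdj _ A (isTerminalEtaleMkId Y)).homEquiv _ _).symm ∘
        ((constantSheafAdj _ A (isTerminalEtaleBaseChangeObjMkId f)).homEquiv _ _) from
    funext fun g => etalePushforwardConstantSheafUnit_comp_map f M g]
  exact (Equiv.bijective _).comp (Equiv.bijective _)

end DegreeZero

end Literature.AlgebraicGeometry.Motives
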